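import Literature.IUT.HodgeTheaters.BadLocalFrobenioidOfKitsTempered
import Literature.AnabelianGeometry.EtaleTheta.FrdIVocabularyWeak
import Literature.AnabelianGeometry.EtaleTheta.RealifiedDivisorMonoidsOfRlfWeak
import HarnessLib

/-!
# [IUTchI] Ex. 3.2 (i) / [EtTh] Def. 3.6 (ii) at the ARITHMETIC theta tower over `𝒟_v̲ = CosetCat Π_v̲`:
# the TYPE of the carrier — the decoupling spec `CarrierSpec` (S0), the category vocabulary `catVocab`,
# and the carrier DATA `CarrierData` (GAP A item GA-04, TYPE half of D4)

S. Mochizuki, *The étale theta function …*, Publ. RIMS **45** (2009) [MochizukiEtTh2009], Def. 3.3 (iii) p.73,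
Def. 3.6 (i)(ii) pp.76–77 (PDF), §5 p.104; *Inter-universal Teichmüller Theory I* [Mochizuki2012], Ex. 3.2 (i)(ii)
pp.69–71 ("the hyperbolic curve `X̲̲_v` determines a tempered Frobenioid `ℱ̲_v` over the base category `𝒟_v`",
"`Ÿ_v`", "`Θ̲_v`", "`l·ℤ ⊆ Aut(T_{Ÿ_v})`", "`𝒪^×_{K_v} → 𝒪^×(T^÷_{Ÿ_v})`") [cite: MochizukiEtTh2009, Def 3.6 p.77].

GAP A of record G-L5-EX32I-1 (abc-iut cell; RULINGS #317 (2) as amended by #319 (c1)–(c4) and #322 (c2′)/(c3′);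
ruled shapes `plan/L5/GAP-A-SIGNATURES.md` v1 e3ccddf9b87597cf §0/§4; GAP-SIZING-A.md 69de97346848d3e8 §2 D4, §8 D0′,
§10).  Shared binders (§0): `{p} [Fact p.Prime] (d : GaloisValDatum.{0} p) {P : Type} [Group P] [TopologicalSpace P]
(T : BadLocalGroupDatum d.Gal P)`, everything at `Type 0`; `T.Dv = CosetCat P`, `T.proj : T.Dv ⥤ CosetCat d.Gal`,
`T.ydd = ⟨T.Y⟩` (`BadLocalFrobenioidBases.lean`).

WHAT IS HERE (the TYPE half of D4; the inhabitant `temperedFrobenioid d T`, its seven Def. 3.6 (ii) laws and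
`carrierSpec_temperedFrobenioid` are the LAW half, item GA-12):

* **S0 `ArithThetaTower.CarrierSpec d T C : Prop`** for a GENERIC `C : TemperedFrobenioid T' T.Dv VD` over generic
  realified data `T'` on `D₀ := T.Dv` (weak [FrdI] vocabulary) — the DECOUPLING SPEC over which the D5/D6/D8 items
  (`isFrobenioid_of_carrierSpec`, `thetaRestBirat_of_carrierSpec`, `isNonDilating_of_carrierSpec`, …) are stated, never
  over the term (GAP-A-SIGNATURES §5).  Its six fields are (i) intrinsic equations/properties of `(C, T', d, T)` or
  (ii) `∃` of a COMPARISON map to a NAMED tree decl — never the `∃` of a D6/D8 output (abc-iut-crit-A S0 WORD (B),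
  RULINGS #336 (1)): `base_eq` (`C.base = 𝟭`), `Φ_carrier` (`Φ(A)` = the perf-saturation of the image of the LATTICE map
  `Φ₀(A) → Φ₀^ℝ(A)`, i.e. `im(Φ₀(A)^pf → Φ₀(A)^rlf)` — print's "`Φ_W` := the image of `Φ₀^pf`", stated through
  `T'.toR`, not through real coordinates, (C2)), `consts` (the GENUINE constant tower `A ↦ (Ω^{aug A})^×` of
  `T.proj ⋙ d.fieldFunctor` EMBEDS into `B^Λ|F^Λ` naturally, and the genuine value monoids `ord(𝒪^▷_{Ω^{aug A}})`
  embed into the lattice `Φ₀` naturally, with `Div` of a constant = its valuation — RULINGS #321/#322 (c2′):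
  constants through `T.proj`, NOT through `rebase`; this is what carries sub-gap (a) `CdashToC` faithful
  NON-VACUOUSLY in GA-13), `aut_finite` (an endomorphism of a FINITE-INDEX object of `CosetCat P` is an automorphism
  and acts on `Φ(A)` with finite order — the H+ lever for `hnd`, (C1)), `theta` (at `Ÿ_T` the data carry a rational
  function with the GENUINE theta divisor shape `[cusps] − [D₁]`: cuspidal zeros, a non-trivial non-cuspidal pole
  divisor, coprime — the shape of `ThetaTwistTowerTempered.div₀_thetaB₀_mul` / `perfection_coprime_thetaZerosΦ₀`,
  ★ p493549 lineage), `lZ` (the deck transformations `Aut_{𝒟_v}(Ÿ_T)` of `T.ydd` lift BY NAME to `Aut(T_{Ÿ_T})`,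
  `T_{Ÿ_T} = ⟨T.ydd, 1⟩`, as the Frobenius-degree-one, divisor-free, unit-free automorphisms — the FINITE avatar of
  print's `ℤ` at a finite-index `T.Y`, #322 / FOUNDATIONS 13 U2).
* **`ArithThetaTower.catVocab d T : FrdICatStub.{0,0,0} T.Dv := treeCatVocab T.Dv ⟨⊤⟩ ⟨⊤⟩`** — the SAME choice the
  (m1) MODEL v2 made (`GenuineFKitMergeInputsThetaSide.lean` l.153: `(fun _ => True) (fun _ => True)`): the tree's
  [FrdI] Def. 1.1 divisorial-monoid notion, with the two Def. 4.5 (ii) predicates ("rational"/"strictly rational",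
  TODO-merge(abc-iut-L1-t3), consumed by no field of `TemperedFrobenioid`, of the slot `TemperedThetaRest(Birat)` or
  of `CarrierSpec`) set to `⊤`.
* **`ArithThetaTower.CarrierData d T T'`** (data-first form, GAP-A-SIGNATURES §4/§6): the one datum `Φ ⊆ Φ^{ℝ-log}`
  over the identity base functor; `CarrierData.canonical T'` = THE datum of `Φ_carrier`;
  `CarrierData.toTemperedFrobenioid X h₁ … h₅ : TemperedFrobenioid T' T.Dv (catVocab d T)` assembles Def. 3.6 (ii)
  from the data and its five laws (`isConnected`/`isTotallyEpimorphic` of `CosetCat P` are in tree); GA-12's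
  `temperedFrobenioid d T := (CarrierData.canonical (realified d T)).toTemperedFrobenioid …`.
* Satisfiability witnesses per field (crit-A (C3)): `CarrierData.toTemperedFrobenioid_base` (`base_eq := rfl`),
  `CarrierData.canonical_Φ_carrier` (`Φ_carrier := rfl`), `perfSaturation_mrange_toR_ofRlfZWeak` (at GA-03's
  `ofRlfZWeak` data `Φ_carrier` IS the engine's `Φ := im(Φ₀^pf → Φ₀^rlf)` of `TemperedFrobenioid.ofPowDiagonalBase`);
  `consts` := GA-02's `(κ, constDivIncl)` (`B₀(U) = (Ω^{aug U})ˣ × …`, `Φ₀(U) = … × OrdInt (Ω^{aug U})`, RULINGS #334);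
  `aut_finite` := the finite-index lemma `End_P(P/U) = N_P(U)/U` + functoriality of `Φ`; `theta` := GA-10's decreed
  `div Θ̈ = [cusps] − [D₁]` with its PROVED cusp laws; `lZ` := the canonical lift `σ ↦ (1, σ, 0, 1)` of
  `ModelFrobenioid`.

carrier: genuine-by-[EtTh]-recipe on the T-lattice (Ÿ_T, Ÿ_T × V, X̲̲_v̲ × V) + constants everywhere; off-lattice Φ
via `rebase`/pullback; [EtTh] Def 3.3 Φ at general U and print's Ÿ̈/μ_N Kummer levels = FOUNDATIONS 13/14, not claimed
(RULINGS #322 (c3′), label of record).  GUARD (#322): for a `T` that is not a finite level of the theta tower the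
carrier is print's recipe TRANSPORTED by the numerical invariants (n_T, e(V|K_v̲)) — a uniform definitional extension
with no print counterpart at that `T`; the C0 NV witness (GA-15) sits at a THETA-TYPE `T`.

HONEST FRAMING: a TYPE file — a `Prop`-valued specification, a vocabulary record and a data structure with its
assembler; TYPED ≠ INHABITED ≠ proved-in-print; nothing here constructs the carrier (GA-02/GA-03/GA-10/GA-12) or
asserts it exists; an UNDISPUTED construction around [IUTchIII] Cor. 3.12, which stays OPEN by charter (D-0045) — no
side is taken on it or on any author; nothing here asserts the abc conjecture proved or refuted; count-neutral.
No instance, no notation, no attribute manipulation, no `sorry`.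
-/

noncomputable section

namespace Literature.AnabelianGeometry.EtaleTheta

namespace ArithThetaTower

open CategoryTheory Opposite Function Literature.AlgebraicGeometry.Frobenioids Literature.AnabelianGeometry.SemiGraphs
  Literature.IUT.HodgeTheaters

variable {p : ℕ} [Fact p.Prime] (d : GaloisValDatum.{0} p) {P : Type} [Group P] [TopologicalSpace P]
  (T : BadLocalGroupDatum d.Gal P)

/-! ## The category vocabulary over `𝒟_v̲` -/

/-- **`catVocab d T`** — the [FrdI] category vocabulary over `𝒟_v̲ = CosetCat Π_v̲` used for the slot's
`VD : FrdICatStub.{0,0,0} T.Dv`: the tree's canonical `treeCatVocab` ("divisorial monoid on `D`" = `IsMonoidOn ∧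
Objectwise IsDivisorial`, [FrdI] Def. 1.1), with the two [FrdI] Def. 4.5 (ii) parameters ⟨r, s⟩ := ⟨⊤, ⊤⟩ — the SAME
choice the (m1) MODEL v2 made (`GenuineFKitMergeInputsThetaSide.lean`, `(fun _ => True) (fun _ => True)`); those two
predicates are consumed by no field of `TemperedFrobenioid`, of `TemperedThetaRest(Birat)` or of `CarrierSpec`
(TODO-merge(abc-iut-L1-t3): [FrdI] §4 rationality). [cite: MochizukiEtTh2009, Def 3.6 p.77] -/
def catVocab : FrdICatStub.{0, 0, 0} T.Dv :=
  treeCatVocab T.Dv (fun (_ : T.Dvᵒᵖ ⥤ CommMonCat.{0}) => True) (fun (_ : T.Dvᵒᵖ ⥤ CommMonCat.{0}) => True)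

/-- `(catVocab d T).IsDivisorialOn Φ` is the tree's "divisorial monoid on `𝒟_v̲`". [cite: MochizukiEtTh2009, Def 3.6 p.77] -/
theorem catVocab_isDivisorialOn (Φ : T.Dvᵒᵖ ⥤ CommMonCat.{0}) :
    (catVocab d T).IsDivisorialOn Φ ↔ IsMonoidOn Φ ∧ Objectwise (fun M _ => IsDivisorial M) Φ :=
  Iff.rfl

/-! ## S0 — the decoupling spec `CarrierSpec` -/

/-- **S0 `CarrierSpec d T C`** — the DECOUPLING SPEC of GAP A (GAP-A-SIGNATURES §4, RULINGS #331/#336 (1)): what the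
D5/D6/D8 items may assume about a tempered Frobenioid `C : TemperedFrobenioid T' T.Dv VD` over `𝒟_v̲ = CosetCat Π_v̲`
(generic realified data `T'` over `D₀ := T.Dv`, weak [FrdI] vocabulary) for it to be «the [EtTh] Def. 3.6 tempered
Frobenioid of the theta-divisor data of the Tate curve over OUR rendering» in the sense of RULINGS #317 (2)/#319/#322:
identity base functor; `Φ` = the perf-saturated lattice image; GENUINE constants `(Ω^{aug A})^×` with their genuine
value monoids at EVERY object via `T.proj` (sub-gap (a) lever); finite-order action of the endomorphisms of finite-index
objects (the `hnd` lever); the genuine theta divisor shape at `Ÿ_T`; the deck transformations of `Ÿ_T` lifted by name.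
Every field is an intrinsic property of `(C, T', d, T)` or the `∃` of a comparison map to a NAMED decl; none posits a
D6/D8 output.  Dischargers at the term (GA-12): `base_eq := rfl`, `Φ_carrier := rfl`
(`CarrierData.canonical_Φ_carrier`, `perfSaturation_mrange_toR_ofRlfZWeak`), `consts := ⟨κ, constDivIncl, …⟩` of
GA-02's direct-sum data, `aut_finite :=` the finite-index lemma for `CosetCat` + functoriality of `C.Φ`, `theta :=`
GA-10's decreed theta divisor with its proved cusp laws, `lZ :=` the canonical `ModelFrobenioid` lift `(1, σ, 0, 1)`.
carrier: genuine-by-[EtTh]-recipe on the T-lattice (Ÿ_T, Ÿ_T × V, X̲̲_v̲ × V) + constants everywhere; off-lattice Φ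
via `rebase`/pullback; [EtTh] Def 3.3 Φ at general U and print's Ÿ̈/μ_N Kummer levels = FOUNDATIONS 13/14, not claimed.
GUARD (#322): for a `T` that is not a finite level of the theta tower the carrier is print's recipe TRANSPORTED by
(n_T, e(V|K_v̲)).  TYPED ≠ INHABITED; no side taken on [IUTchIII] Cor. 3.12; NOT an abc claim.
[cite: MochizukiEtTh2009, Def 3.6 p.77] -/
structure CarrierSpec {T' : RealifiedDivisorMonoids (D₀ := T.Dv) treeMonoidVocabWeak.{0}}
    {VD : FrdICatStub.{0, 0, 0} T.Dv} (C : TemperedFrobenioid T' T.Dv VD) : Prop where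
  /-- the structure functor `D → D₀` is the identity of `𝒟_v̲ = CosetCat Π_v̲` (`D = D₀ = 𝒟_v̲`; RULINGS #321, the
  shape of `TemperedThetaInput.trivial`).  Discharger: `rfl` (`CarrierData.toTemperedFrobenioid_base`). -/
  base_eq : C.base = 𝟭 T.Dv
  /-- `Φ(A) ⊆ Φ^{ℝ-log}(A) = Φ₀^ℝ(Y_A)` IS the perf-saturation ([EtTh] §0) of the image of the LATTICE map
  `Φ₀(Y_A) → Φ₀^ℝ(Y_A)` (`T'.toR`), i.e. `im(Φ₀(Y_A)^pf → Φ₀(Y_A)^rlf)` — print's "`Φ_W` := the image of `Φ₀^pf`"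
  ([EtTh] Ex. 3.9), AS TYPED at every object (#319 (c1)); stated through the lattice, not through real coordinates
  (crit-A (C2)).  Discharger: `rfl` at `CarrierData.canonical`; `= mrange toRealification` at `ofRlfZWeak` data
  (`perfSaturation_mrange_toR_ofRlfZWeak`). -/
  Φ_carrier : ∀ A : T.Dvᵒᵖ, C.Φ.carrier A = perfSaturation (MonoidHom.mrange (T'.toR (C.baseOp A)))
  /-- GENUINE CONSTANTS AT EVERY OBJECT via `T.proj` (RULINGS #321/#322 (c2′): constants through `T.proj ⋙
  d.fieldFunctor`, NOT through `rebase`): the constant tower `Y ↦ (Ω^{aug Y})^×` (`PadicFrd.bZeroOn (T.proj ⋙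
  d.fieldFunctor)`, = GA-01's `T.proj.op ⋙ (ConstTower.ofGaloisValDatum d).units` — TODO-merge(abc-iut-gapA-01-ConstTower),
  `rfl`) EMBEDS naturally into `B₀^Λ` with image in the constants `F₀^Λ`, the genuine value monoids
  `ord(𝒪^▷_{Ω^{aug Y}})` (`PadicFrd.OrdInt`) EMBED naturally (along `PadicFrd.ordIntMapOfHom` of `d.fixedHom`, so the
  ramification indices `e(V′|V)` are the genuine ones) into the lattice `Φ₀`, and `Div` of a constant IS its valuation
  (`PadicFrd.divUnits`) read through the lattice map.  This is the NON-VACUOUS sub-gap (a) lever: GA-13 builds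
  `CdashToC : d.Cdash hq ⥤ C.hullCategory` faithful from `(κ, ι)`; GA-06 builds `constUnits` from `κ` at `Ÿ_T`
  (`aug(Π_Ÿ) = G_v`, so `Ω^{aug Ÿ_T} = K_v̲`).  Discharger: GA-02's `⟨κ, constDivIncl, …⟩` (RULINGS #334 (2)(b)). -/
  consts : ∃ (κ : PadicFrd.bZeroOn (T.proj ⋙ d.fieldFunctor) ⟶ T'.BΛ)
      (ι : ∀ Y : T.Dvᵒᵖ, PadicFrd.OrdInt (d.fieldFunctor.obj (T.proj.obj (unop Y))).K →* (T'.Φ₀.obj Y : Type)),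
      (∀ Y : T.Dvᵒᵖ, Injective (κ.app Y).hom) ∧ (∀ Y : T.Dvᵒᵖ, Injective (ι Y)) ∧
      (∀ (Y : T.Dvᵒᵖ) (u : ((d.fieldFunctor.obj (T.proj.obj (unop Y))).K)ˣ), (κ.app Y).hom u ∈ T'.FΛ Y) ∧
      (∀ {Y Y' : T.Dvᵒᵖ} (f : Y ⟶ Y') (x : PadicFrd.OrdInt (d.fieldFunctor.obj (T.proj.obj (unop Y))).K),
        (T'.Φ₀.map f).hom (ι Y x) =
          ι Y' (PadicFrd.ordIntMapOfHom (d.fieldFunctor.map (T.proj.map f.unop)).alg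
            (d.fieldFunctor.map (T.proj.map f.unop)).isValHom x)) ∧
      (∀ (Y : T.Dvᵒᵖ) (u : ((d.fieldFunctor.obj (T.proj.obj (unop Y))).K)ˣ),
        T'.divΛ Y ((κ.app Y).hom u) =
          gpMap (T'.toR Y) (gpMap (ι Y) (PadicFrd.divUnits (d.fieldFunctor.obj (T.proj.obj (unop Y))).K u)))
  /-- THE `hnd` LEVER (#319 H+, memo §7; crit-A (C1) TRUE AS TYPED at the slot, where every open subgroup of
  `Π_v̲ = ↥(B x hx).H ≤ Π_{C_F}` has finite index): an endomorphism of a FINITE-INDEX object `Π/U` of `𝒟_v̲` is an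
  automorphism (`End_Π(Π/U) = N_Π(U)/U`, a finite group) and the endomorphism of `Φ(Π/U)` it induces has FINITE ORDER —
  hence permutes the primaries and cannot rescale inside a prime (`eq_self_of_iterate_eq_id_of_le`,
  `isNonDilating_of_forall_isPrimary`, [FrdI] Thm. 6.4 (i) pattern).  (That it acts trivially on the constants'
  divisors follows from `consts`: `ι` is natural and `Gal(Ω/K_v̲)` preserves the valuation, `GaloisValDatum.val_aut`.)
  Discharger: the finite-index lemma for `CosetCat P` + functoriality of `C.Φ.toFunctor`. -/
  aut_finite : ∀ (A : T.Dv) (f : A ⟶ A), A.sg.toSubgroup.FiniteIndex →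
      IsIso f ∧ ∃ n : ℕ, 0 < n ∧ ∀ a : C.Φ.carrier (op A), (⇑(C.Φ.pull f.op))^[n] a = a
  /-- THE GENUINE THETA DIVISOR AT `Ÿ_T = ⟨T.Y⟩` (#322 (c2′) «`Θ̲ := thetaUnit` at the matching skeleton level WITH its
  genuine divisor»; [EtTh] Prop. 1.4 (i) / §5 p.104: the theta function has zeros exactly at the cusps and poles along
  the special-fibre components `D₁`-translates): the data carry at `Y_{Ÿ_T}` a rational function `θ ∈ B₀^Λ(Ÿ_T)` and
  effective lattice divisors `Z` (CUSPIDAL, `≠ 0`) and `Pl` (NON-CUSPIDAL, `≠ 0`), COPRIME, with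
  `Div(θ) + [Pl] = [Z]` read through the lattice map — the shape of the fourth model's `thetaB₀`/`div₀_thetaB₀_mul`/
  `perfection_coprime_thetaZerosΦ₀` (`ThetaFractionPairOfThetaTwistTower.lean`, ★ p493549 lineage) BY NAME; GA-06 takes
  `Θ̲ :=` the image of `(θ, Div θ) ∈ B(Ÿ_T)` under `PreFrobenioid.toBirat`, GA-16 its fraction-pair.  (A literal monoid
  comparison map from the fourth model's `B₀(Y_n)` is NOT posited: GA-10's decreed avatar is `ϖ̈`-free.)
  Discharger: GA-10's decreed `div Θ̈ = [cusps] − [D₁]` with its proved cusp laws, through GA-02's direct sum. -/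
  theta : ∃ (θ : (T'.BΛ.obj (op T.ydd) : Type)) (Z Pl : (T'.Φ₀.obj (op T.ydd) : Type)),
      Z ∈ T'.csp₀ (op T.ydd) ∧ Pl ∈ T'.ncsp₀ (op T.ydd) ∧ Z ≠ 1 ∧ Pl ≠ 1 ∧ IsRelPrime Z Pl ∧
      T'.divΛ (op T.ydd) θ * Algebra.GrothendieckGroup.of (T'.toR (op T.ydd) Pl) =
        Algebra.GrothendieckGroup.of (T'.toR (op T.ydd) Z)
  /-- THE DECK TRANSFORMATIONS OF `Ÿ_T` LIFT BY NAME (#322 (c2′) «`lZ` := the image of `l·`(deck translations of `Ÿ_T`)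
  BY NAME, whatever it evaluates to at the given `T`» — small/`⊥` when `n_T ∣ l`: a LABELLED finite-avatar consequence,
  FOUNDATIONS 13 U2, not a defect; crit-A (C1): the FINITE avatar at a finite-index `T.Y`, never `≅ ℤ`): there is a
  group homomorphism `Aut_{𝒟_v̲}(Ÿ_T) → Aut(T_{Ÿ_T})`, `T_{Ÿ_T} = ⟨T.ydd, 1⟩` the Frobenius-trivial object, whose value
  at `σ` lies over `σ` with trivial zero divisor and trivial unit; GA-06 sets `lZ :=` its image of the `l`-th powers.
  Discharger: the canonical `ModelFrobenioid` lift `σ ↦ (1, σ, 0, 1)`. -/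
  lZ : ∃ Λ : Aut T.ydd →* Aut (⟨T.ydd, 1⟩ : C.category),
      ∀ σ : Aut T.ydd, (Λ σ).hom.base = σ.hom ∧ (Λ σ).hom.div = 1 ∧ (Λ σ).hom.unit = 1

/-! ## The carrier DATA over the identity base functor -/

/-- **`CarrierData d T T'`** — the DATA of the carrier of [EtTh] Def. 3.6 (ii) over `𝒟_v̲` at realified data `T'`
(data-first form of GAP-A-SIGNATURES §4/§6): the structure functor is FIXED to `𝟭 T.Dv` (`base_eq`), so the one datum
is the subfunctor `Φ ⊆ Φ^{ℝ-log} := Φ₀^ℝ|_{𝒟_v̲}`.  THE datum of record is `CarrierData.canonical` (`Φ_carrier`).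
carrier: genuine-by-[EtTh]-recipe on the T-lattice (Ÿ_T, Ÿ_T × V, X̲̲_v̲ × V) + constants everywhere; off-lattice Φ
via `rebase`/pullback; [EtTh] Def 3.3 Φ at general U and print's Ÿ̈/μ_N Kummer levels = FOUNDATIONS 13/14, not claimed;
GUARD (#322): at a `T` that is not a finite theta-tower level the carrier is print's recipe transported by
(n_T, e(V|K_v̲)).  TYPED ≠ INHABITED. [cite: MochizukiEtTh2009, Def 3.6 p.76] -/
structure CarrierData (T' : RealifiedDivisorMonoids (D₀ := T.Dv) treeMonoidVocabWeak.{0}) : Type where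
  /-- `Φ ⊆ Φ^{ℝ-log} := Φ₀^ℝ|_{𝒟_v̲}` over the identity base functor -/
  Φ : SubMonoidOn ((𝟭 T.Dv).op ⋙ T'.ΦR)

namespace CarrierData

variable {d T} {T' : RealifiedDivisorMonoids (D₀ := T.Dv) treeMonoidVocabWeak.{0}}

/-- The structure functor of the carrier data: the identity of `𝒟_v̲`. [cite: MochizukiEtTh2009, Def 3.6 p.76] -/
abbrev base (_X : CarrierData d T T') : T.Dv ⥤ T.Dv := 𝟭 T.Dv

variable (T') in
/-- **THE carrier datum of record**: `Φ(A) :=` the perf-saturation of the image of the lattice map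
`Φ₀(A) → Φ₀^ℝ(A)` (= `im(Φ₀(A)^pf → Φ₀(A)^rlf)`, print's "`Φ_W` := the image of `Φ₀^pf`"), a subfunctor in monoids
by the naturality of `Φ₀ → Φ₀^ℝ`. [cite: MochizukiEtTh2009, Def 3.6 p.76] -/
def canonical : CarrierData d T T' where
  Φ :=
    { carrier := fun A => perfSaturation (MonoidHom.mrange (T'.toR A))
      map_mem := by
        rintro A B f x ⟨n, a, ha⟩
        refine ⟨n, (T'.Φ₀.map f).hom a, ?_⟩
        change T'.toR B ((T'.Φ₀.map f).hom a) = (T'.ΦR.map f).hom x ^ (n : ℕ)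
        exact (T'.toR_natural f a).trans (((congrArg (T'.ΦR.map f).hom ha)).trans (map_pow _ x n)) }

/-- `Φ(A)` of the canonical datum, definitionally. [cite: MochizukiEtTh2009, Def 3.6 p.76] -/
theorem canonical_Φ_carrier (A : T.Dvᵒᵖ) :
    (canonical T' (d := d) (T := T)).Φ.carrier A = perfSaturation (MonoidHom.mrange (T'.toR A)) := rfl

/-- **Def. 3.6 (ii) ASSEMBLED from carrier data and its five laws** (`𝒟_v̲ = CosetCat Π_v̲` is connected and totally
epimorphic — in tree): the `TemperedFrobenioid T' T.Dv (catVocab d T)` with structure functor `𝟭` and divisor monoid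
`X.Φ`; GA-12 supplies the laws at `X := canonical (realified d T)`. [cite: MochizukiEtTh2009, Def 3.6 p.77] -/
def toTemperedFrobenioid (X : CarrierData d T T')
    (h₁ : ∀ A : T.Dvᵒᵖ, IsGroupSaturated (X.Φ.carrier A))
    (h₂ : ∀ A : T.Dvᵒᵖ, treeMonoidVocabWeak.{0}.IsPerfFactorial (X.Φ.carrier A))
    (h₃ : (catVocab d T).IsDivisorialOn X.Φ.toFunctor)
    (h₄ : ∀ A : T.Dvᵒᵖ, IsMonoprime
      ↥(X.Φ.carrier A ⊓ (T'.cnstR (op ((𝟭 T.Dv).obj (unop A)))).toSubmonoid.comap Algebra.GrothendieckGroup.of))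
    (h₅ : ∀ A : T.Dvᵒᵖ, ∃ b ∈ T'.FΛ (op ((𝟭 T.Dv).obj (unop A))),
      ∃ x ∈ X.Φ.carrier A, ∃ y ∈ X.Φ.carrier A, x ≠ y ∧
        T'.divΛ _ b = Algebra.GrothendieckGroup.of x / Algebra.GrothendieckGroup.of y) :
    TemperedFrobenioid T' T.Dv (catVocab d T) where
  isConnected := CosetCat.isConnected
  isTotallyEpimorphic := CosetCat.isTotallyEpimorphic
  base := 𝟭 T.Dv
  Φ := X.Φ
  isGroupSaturated := h₁
  isPerfFactorial := h₂
  isDivisorialOn := h₃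
  isMonoprime_bsFld := h₄
  exists_FΛ_div_ne := h₅

/-- Its structure functor is the identity (the `base_eq` clause of `CarrierSpec`, by `rfl`).
[cite: MochizukiEtTh2009, Def 3.6 p.77] -/
theorem toTemperedFrobenioid_base (X : CarrierData d T T') (h₁ h₂ h₃ h₄ h₅) :
    (X.toTemperedFrobenioid h₁ h₂ h₃ h₄ h₅).base = 𝟭 T.Dv := rfl

/-- Its divisor monoid is the datum `X.Φ`. [cite: MochizukiEtTh2009, Def 3.6 p.77] -/
theorem toTemperedFrobenioid_Φ (X : CarrierData d T T') (h₁ h₂ h₃ h₄ h₅) :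
    (X.toTemperedFrobenioid h₁ h₂ h₃ h₄ h₅).Φ = X.Φ := rfl

/-- At the canonical datum the `Φ_carrier` clause of `CarrierSpec` holds by `rfl`. [cite: MochizukiEtTh2009, Def 3.6 p.77] -/
theorem canonical_toTemperedFrobenioid_Φ_carrier (h₁ h₂ h₃ h₄ h₅) (A : T.Dvᵒᵖ) :
    ((canonical T' (d := d) (T := T)).toTemperedFrobenioid h₁ h₂ h₃ h₄ h₅).Φ.carrier A =
      perfSaturation (MonoidHom.mrange (T'.toR
        (((canonical T' (d := d) (T := T)).toTemperedFrobenioid h₁ h₂ h₃ h₄ h₅).baseOp A))) := rfl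

end CarrierData

/-! ## `Φ_carrier` at CONSTRUCTED weak data of monoid type `ℤ` is the engines' `Φ := im(Φ₀^pf → Φ₀^rlf)` -/

/-- At `RealifiedDivisorMonoids.ofRlfZWeak dm hpf` (GA-03's `realified d T` is of this form) the perf-saturation of the
image of `Φ₀(Y) → Φ₀^ℝ(Y)` IS the image of `Φ₀(Y)^pf → Φ₀(Y)^rlf` — the `Φ` of every Def. 3.6 (ii) engine in the tree
(`TemperedFrobenioid.ofPowDiagonalBase`, `ofRankOnePoint`, ★ p493549): a root of `ι(a)` in the PERFECT monoid
`Φ₀(Y)^rlf` is the image of the corresponding root in `Φ₀(Y)^pf`. [cite: MochizukiEtTh2009, Def 3.6 p.76] -/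
theorem perfSaturation_mrange_toR_ofRlfZWeak {D₀ : Type} [Category.{0} D₀] (dm : DivisorMonoids.{0, 0, 0} D₀)
    (hpf : ∀ Y : D₀ᵒᵖ, IsPerfFactorialCof (dm.Φ₀.obj Y)) (Y : D₀ᵒᵖ) :
    perfSaturation (MonoidHom.mrange ((RealifiedDivisorMonoids.ofRlfZWeak dm hpf).toR Y)) =
      MonoidHom.mrange (hpf Y).weak.toRealification := by
  ext x
  constructor
  · rintro ⟨n, a, ha⟩
    refine ⟨Perfection.mk a n, ?_⟩
    apply ((IsPerfFactorialWeak.Rlf.isPerfect (hpf Y).weak).bijective_pow n n.pos).1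
    change (hpf Y).weak.toRealification (Perfection.mk a n) ^ (n : ℕ) = x ^ (n : ℕ)
    rw [← map_pow, Perfection.mk_pow_self, ← ha]
    rfl
  · rintro ⟨b, rfl⟩
    obtain ⟨⟨a, n⟩, rfl⟩ := Perfection.mk_surjective b
    refine ⟨n, a, ?_⟩
    change (hpf Y).weak.toRealification (Perfection.of _ a) =
      (hpf Y).weak.toRealification (Perfection.mk a n) ^ (n : ℕ)
    rw [← map_pow, Perfection.mk_pow_self]

end ArithThetaTower

end Literature.AnabelianGeometry.EtaleTheta

end
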